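import Mathlib
import Summits.Ventures.PercRepro2.Defs
import Summits.Ventures.PercRepro2.Graph
import Summits.Ventures.PercRepro2.OneColourSwitch
import Summits.Ventures.PercRepro2.RegionHubSign
import Summits.Ventures.PercRepro2.SideSwitch
import Summits.Ventures.PercRepro2.SideSwitchComps
import Summits.Ventures.PercRepro2.M9NoPocketDefs

/-!
# A virtual edge (blind cell PercRepro2, p3 g42, 2026-08-30; `proofs/P3-POCKETRK.md` §10⁶ (b):
the virtual `T`-edge of the `{r, s, d}`-cluster type calculus)

The graph `G⁺` on the edge type `Option E` with one more edge `none` between `a` and `b`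
(`fun e : Option E => e.elim s(a, b) ends`).  A colouring of `G⁺` is a colouring of `G`
(`ωp ∘ some`) together with the colour of the new edge.  Connections: when the new edge is
closed nothing changes (`conn_virt_iff_of_closed`); when it is open, `x ~ y` in `G⁺` iff
`x ~ y` in `G` or the path uses the new edge once — `x ~ a, b ~ y` or `x ~ b, a ~ y`
(`conn_virt_iff_of_open`).  With `a = d` the new edge is a loop at `d` in `G⁺ − d`
(`endsD`), so the looped graphs of `G⁺` and `G` have the same connections
(`conn_endsD_virt_iff`), the same `chi`-configurations (`chi_endsD_virt_some`), and the
separation hypothesis «the neighbourhood of `d` separates `r` from `s` in `G − d`» transfers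
(`sepN_virt`, for `b ∈ {r, s}`); an edge inside `{r, s}` of `G⁺` is one of `G`
(`within_rs_virt_eq_empty`).  Own work; std axioms.
-/

namespace Summit.Ventures.PercRepro2

namespace NoPocket

open Finset Classical OneColourSwitch SideSwitch

variable {V : Type*} {E : Type*} {ends : E → Sym2 V} {a b : V}

section Virtual

/-- A connection of `G` is a connection of `G⁺` (the colouring restricted along `some`). -/
lemma conn_virt_of_conn {ωp : Config (Option E)} {x y : V}
    (h : Conn ends (fun e => ωp (some e)) x y) :
    Conn (fun e : Option E => e.elim s(a, b) ends) ωp x y := by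
  refine mem_of_conn_of_closed (S := {z | Conn (fun e : Option E => e.elim s(a, b) ends) ωp x z})
    ?_ (conn_refl _ _ _) h
  intro u hu v huv
  obtain ⟨_, e, he, hends⟩ := openGraph_adj.1 huv
  exact conn_trans hu (conn_of_openAdj ⟨some e, he, hends⟩)

/-- **The new edge closed**: the connections of `G⁺` are those of `G`. -/
lemma conn_virt_iff_of_closed {ωp : Config (Option E)} (h0 : ωp none = false) {x y : V} :
    Conn (fun e : Option E => e.elim s(a, b) ends) ωp x y ↔
      Conn ends (fun e => ωp (some e)) x y := by
  constructor
  · intro h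
    refine mem_of_conn_of_closed (S := {z | Conn ends (fun e => ωp (some e)) x z}) ?_
      (conn_refl _ _ _) h
    intro u hu v huv
    obtain ⟨_, e, he, hends⟩ := openGraph_adj.1 huv
    rcases e with _ | e
    · rw [h0] at he; exact absurd he Bool.false_ne_true
    · exact conn_trans hu (conn_of_openAdj ⟨e, he, hends⟩)
  · exact conn_virt_of_conn

/-- **The new edge open**: `x ~ y` in `G⁺` iff `x ~ y` in `G`, or the path crosses the new edge
`{a, b}` (once). -/
lemma conn_virt_iff_of_open {ωp : Config (Option E)} (h1 : ωp none = true) {x y : V} :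
    Conn (fun e : Option E => e.elim s(a, b) ends) ωp x y ↔
      Conn ends (fun e => ωp (some e)) x y ∨
      (Conn ends (fun e => ωp (some e)) x a ∧ Conn ends (fun e => ωp (some e)) b y) ∨
      (Conn ends (fun e => ωp (some e)) x b ∧ Conn ends (fun e => ωp (some e)) a y) := by
  constructor
  · intro h
    refine mem_of_conn_of_closed (S := {z | Conn ends (fun e => ωp (some e)) x z ∨
      (Conn ends (fun e => ωp (some e)) x a ∧ Conn ends (fun e => ωp (some e)) b z) ∨
      (Conn ends (fun e => ωp (some e)) x b ∧ Conn ends (fun e => ωp (some e)) a z)}) ?_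
      (Or.inl (conn_refl _ _ _)) h
    intro u hu v huv
    simp only [Set.mem_setOf_eq] at hu ⊢
    obtain ⟨_, e, he, hends⟩ := openGraph_adj.1 huv
    rcases e with _ | e
    · -- the new edge: `{u, v} = {a, b}`
      simp only [Option.elim] at hends
      rw [Sym2.eq_iff] at hends
      rcases hends with ⟨hau, hbv⟩ | ⟨hav, hbu⟩
      · subst hau; subst hbv
        rcases hu with hu | ⟨hu1, _⟩ | ⟨hu1, _⟩
        · exact Or.inr (Or.inl ⟨hu, conn_refl _ _ _⟩)
        · exact Or.inr (Or.inl ⟨hu1, conn_refl _ _ _⟩)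
        · exact Or.inl hu1
      · subst hav; subst hbu
        rcases hu with hu | ⟨hu1, _⟩ | ⟨hu1, _⟩
        · exact Or.inr (Or.inr ⟨hu, conn_refl _ _ _⟩)
        · exact Or.inl hu1
        · exact Or.inr (Or.inr ⟨hu1, conn_refl _ _ _⟩)
    · have hadj : Conn ends (fun e => ωp (some e)) u v := conn_of_openAdj ⟨e, he, hends⟩
      rcases hu with hu | ⟨hu1, hu2⟩ | ⟨hu1, hu2⟩
      · exact Or.inl (conn_trans hu hadj)
      · exact Or.inr (Or.inl ⟨hu1, conn_trans hu2 hadj⟩)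
      · exact Or.inr (Or.inr ⟨hu1, conn_trans hu2 hadj⟩)
  · have hab : Conn (fun e : Option E => e.elim s(a, b) ends) ωp a b :=
      conn_of_openAdj ⟨none, h1, rfl⟩
    rintro (h | ⟨h1', h2⟩ | ⟨h1', h2⟩)
    · exact conn_virt_of_conn h
    · exact conn_trans (conn_virt_of_conn h1') (conn_trans hab (conn_virt_of_conn h2))
    · exact conn_trans (conn_virt_of_conn h1') (conn_trans (conn_symm hab) (conn_virt_of_conn h2))

/-- The colour flip commutes with the restriction along `some`. -/
lemma compl_virt_some (ωp : Config (Option E)) :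
    (fun e => OneColourSwitch.compl ωp (some e)) = OneColourSwitch.compl (fun e => ωp (some e)) :=
  rfl

/-- The edges inside `{r, s}` of `G⁺` are those of `G` when the new edge is not inside
`{r, s}`. -/
lemma within_rs_virt_eq_empty {r s : V} (hrs : within ends ({r, s} : Set V) = ∅)
    (ha : a ∉ ({r, s} : Set V)) :
    within (fun e : Option E => e.elim s(a, b) ends) ({r, s} : Set V) = ∅ := by
  ext e
  simp only [Set.mem_empty_iff_false, iff_false]
  rintro ⟨x, hx, y, hy, hxy⟩
  rcases e with _ | e
  · simp only [Option.elim] at hxy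
    rw [Sym2.eq_iff] at hxy
    rcases hxy with ⟨h1, _⟩ | ⟨h1, _⟩
    · exact ha (h1 ▸ hx)
    · exact ha (h1 ▸ hy)
  · have : e ∈ within ends ({r, s} : Set V) := ⟨x, hx, y, hy, hxy⟩
    rw [hrs] at this
    exact this

end Virtual

section Looped

variable {d : V}

/-- In `G⁺ − d` the new edge at `d` is a loop: on the real edges the looped graphs agree. -/
lemma endsD_virt_some (e : E) :
    endsD (fun e : Option E => e.elim s(d, b) ends) d (some e) = endsD ends d e := rfl

/-- The new edge `{d, b}` is a loop at `d` in `G⁺ − d`. -/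
lemma endsD_virt_none :
    endsD (fun e : Option E => e.elim s(d, b) ends) d none = s(d, d) := by
  simp [endsD]

/-- **The looped graphs of `G⁺` and `G` have the same connections** (for every colouring): a
loop never gives an adjacency. -/
lemma conn_endsD_virt_iff {ωp : Config (Option E)} {x y : V} :
    Conn (endsD (fun e : Option E => e.elim s(d, b) ends) d) ωp x y ↔
      Conn (endsD ends d) (fun e => ωp (some e)) x y := by
  constructor
  · intro h
    refine mem_of_conn_of_closed (S := {z | Conn (endsD ends d) (fun e => ωp (some e)) x z}) ?_
      (conn_refl _ _ _) h
    intro u hu v huv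
    obtain ⟨hne, e, he, hends⟩ := openGraph_adj.1 huv
    rcases e with _ | e
    · rw [endsD_virt_none, Sym2.eq_iff] at hends
      exfalso
      rcases hends with ⟨h1, h2⟩ | ⟨h1, h2⟩
      · exact hne (h1.symm.trans h2)
      · exact hne (h2.symm.trans h1)
    · rw [endsD_virt_some] at hends
      exact conn_trans hu (conn_of_openAdj ⟨e, he, hends⟩)
  · intro h
    refine mem_of_conn_of_closed
      (S := {z | Conn (endsD (fun e : Option E => e.elim s(d, b) ends) d) ωp x z}) ?_
      (conn_refl _ _ _) h
    intro u hu v huv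
    obtain ⟨_, e, he, hends⟩ := openGraph_adj.1 huv
    exact conn_trans hu (conn_of_openAdj ⟨some e, he, by rw [endsD_virt_some]; exact hends⟩)

/-- The `chi`-configuration of the looped graph of `G⁺`, restricted along `some`, is that of
the looped graph of `G`. -/
lemma chi_endsD_virt_some (S : Set V) :
    (fun e => chi (endsD (fun e : Option E => e.elim s(d, b) ends) d) S (some e)) =
      chi (endsD ends d) S := by
  funext e
  simp only [chi]
  rw [decide_eq_decide]
  constructor
  · rintro ⟨x, hx, y, hy, hxy⟩
    exact ⟨x, hx, y, hy, by rw [← endsD_virt_some (b := b) e]; exact hxy⟩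
  · rintro ⟨x, hx, y, hy, hxy⟩
    exact ⟨x, hx, y, hy, by rw [endsD_virt_some]; exact hxy⟩

/-- The non-neighbours of `d` in `G⁺` together with `r, s` are those of `G` together with
`r, s`, when the new edge goes to `b ∈ {r, s}`. -/
lemma nonNbrs_virt_union {r s : V} (hb : b = r ∨ b = s) :
    ({x : V | ∀ e : Option E, (fun e : Option E => e.elim s(d, b) ends) e ≠ s(d, x)} ∪ {r, s}
      : Set V) = {x : V | ∀ e : E, ends e ≠ s(d, x)} ∪ {r, s} := by
  ext x
  simp only [Set.mem_union, Set.mem_setOf_eq, Set.mem_insert_iff, Set.mem_singleton_iff]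
  constructor
  · rintro (h | h)
    · exact Or.inl (fun e => h (some e))
    · exact Or.inr h
  · rintro (h | h)
    · by_cases hxb : x = b
      · subst hxb
        rcases hb with rfl | rfl
        · exact Or.inr (Or.inl rfl)
        · exact Or.inr (Or.inr rfl)
      · refine Or.inl ?_
        intro e
        rcases e with _ | e
        · simp only [Option.elim]
          intro h'
          rw [Sym2.eq_iff] at h'
          rcases h' with ⟨_, h2⟩ | ⟨h1, h2⟩
          · exact hxb h2.symm
          · exact hxb (h1.symm.trans h2.symm)
        · exact h e
    · exact Or.inr h

/-- **The separation hypothesis transfers to `G⁺`**: if no `r`–`s` path of `G − d` runs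
through non-neighbours of `d` (and `r`, `s`), the same holds in `G⁺ − d` for the new edge
`{d, b}` with `b ∈ {r, s}`. -/
lemma sepN_virt {r s : V} (hb : b = r ∨ b = s)
    (hsepN : ¬ Conn (endsD ends d) (chi (endsD ends d)
      ({x : V | ∀ e, ends e ≠ s(d, x)} ∪ {r, s})) r s) :
    ¬ Conn (endsD (fun e : Option E => e.elim s(d, b) ends) d)
      (chi (endsD (fun e : Option E => e.elim s(d, b) ends) d)
        ({x : V | ∀ e : Option E, (fun e : Option E => e.elim s(d, b) ends) e ≠ s(d, x)} ∪
          {r, s})) r s := by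
  intro h
  apply hsepN
  rw [conn_endsD_virt_iff, chi_endsD_virt_some, nonNbrs_virt_union hb] at h
  exact h

end Looped

end NoPocket

end Summit.Ventures.PercRepro2
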